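import Summits.AtomisticToContinuum.FouriersLaw.Theorems.HiddenChargeMazurDressedChargeMainReductionAux1

/-!
# Main reduction for stub S1 of crux `DressedCharge` — helper 5: structure of the triple plane-wave
# transform of an even cubic

Crux stmt-AtomisticToContinuum-13509 (`HiddenChargeMazur.DressedCharge`), line `birth`, stub G
`stub_mainReduction` (lead). For a momentum-EVEN complex lattice polynomial `f` and the plane-wave
derivations `D_(z,μ) = mkDerivation ℂ (q_x ↦ z^x, p_x ↦ μ z^x)`, the constant coefficient of
`D_(z₁,μ₁) (D_(z₂,μ₂) (D_(1,μ₃) f))` has the form `c0 z₁ z₂ + μ₁μ₂ c12 z₁ z₂ + μ₁μ₃ c13 z₁ z₂ + μ₂μ₃ c23 z₁ z₂`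
with LAURENT coefficient functions (`c · (z₁z₂)^N` polynomial): the words with an odd number of
momentum derivations vanish by reversal symmetry, and the coefficients are evaluations of fixed
polynomials obtained from GENERIC plane waves over `MvPolynomial (Fin 4) ℂ` (variables `Z₁, Z₂, Z₁⁻¹, Z₂⁻¹`).
No definitions, no notation.
-/

noncomputable section

namespace Summit.AtomisticToContinuum.FouriersLaw.Theorems.DressedCharge

open MvPolynomial

/-! ## Reversal parity of constant-coefficient derivations -/

/-- A `mkDerivation` on the lattice ring whose generator assignment is even on positions and odd on
momenta under `Θ` (as a pure position plane-wave derivation: constants on `q`, zero on `p`) COMMUTES with `Θ`. -/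
theorem mkDerivation_theta_of_parity' {R : Type*} [CommRing R] (h : ℤ ⊕ ℤ → MvPolynomial (ℤ ⊕ ℤ) R)
    (hq : ∀ i, MvPolynomial.aeval (R := R) (Sum.elim (fun i : ℤ => (X (Sum.inl i) : MvPolynomial (ℤ ⊕ ℤ) R))
      (fun i : ℤ => -X (Sum.inr i))) (h (Sum.inl i)) = h (Sum.inl i))
    (hp : ∀ i, MvPolynomial.aeval (R := R) (Sum.elim (fun i : ℤ => (X (Sum.inl i) : MvPolynomial (ℤ ⊕ ℤ) R))
      (fun i : ℤ => -X (Sum.inr i))) (h (Sum.inr i)) = -h (Sum.inr i))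
    (f : MvPolynomial (ℤ ⊕ ℤ) R) :
    MvPolynomial.mkDerivation R h (MvPolynomial.aeval (R := R)
      (Sum.elim (fun i : ℤ => (X (Sum.inl i) : MvPolynomial (ℤ ⊕ ℤ) R)) (fun i : ℤ => -X (Sum.inr i))) f) =
    MvPolynomial.aeval (R := R)
      (Sum.elim (fun i : ℤ => (X (Sum.inl i) : MvPolynomial (ℤ ⊕ ℤ) R)) (fun i : ℤ => -X (Sum.inr i)))
      (MvPolynomial.mkDerivation R h f) := by
  induction f using MvPolynomial.induction_on with
  | C r => simp
  | add p q hp' hq' => rw [map_add, map_add, hp', hq', map_add, map_add]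
  | mul_X p v hp' =>
    rcases v with x | x
    · simp only [map_mul, theta_X_inl, Derivation.leibniz, smul_eq_mul, mkDerivation_X, map_add, hp', hq]
    · simp only [map_mul, theta_X_inr, map_neg, Derivation.leibniz, smul_eq_mul,
        mkDerivation_X, map_add, hp', hp]

/-- `Θ` does not change the constant coefficient. -/
theorem constantCoeff_theta {R : Type*} [CommRing R] (f : MvPolynomial (ℤ ⊕ ℤ) R) :
    constantCoeff (MvPolynomial.aeval (R := R)
      (Sum.elim (fun i : ℤ => (X (Sum.inl i) : MvPolynomial (ℤ ⊕ ℤ) R)) (fun i : ℤ => -X (Sum.inr i))) f) =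
    constantCoeff f := by
  induction f using MvPolynomial.induction_on with
  | C r => simp
  | add p q hp hq => simp only [map_add, hp, hq]
  | mul_X p v hp =>
    simp only [map_mul, constantCoeff_X, mul_zero]
    rcases v with x | x <;> simp

/-! ## The two elementary plane-wave derivations -/

section PlaneWave

/-- Splitting of a plane-wave derivation into position and momentum parts: `D_(z,μ) = D^q_z + μ D^p_z`. -/
theorem planeWave_split (z μ : ℂ) (f : MvPolynomial (ℤ ⊕ ℤ) ℂ) :
    MvPolynomial.mkDerivation ℂ (Sum.elim (fun x : ℤ => (C (z ^ x) : MvPolynomial (ℤ ⊕ ℤ) ℂ))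
        (fun x : ℤ => C (μ * z ^ x))) f =
      MvPolynomial.mkDerivation ℂ (Sum.elim (fun x : ℤ => (C (z ^ x) : MvPolynomial (ℤ ⊕ ℤ) ℂ))
          (fun _ : ℤ => 0)) f +
        μ • MvPolynomial.mkDerivation ℂ (Sum.elim (fun _ : ℤ => (0 : MvPolynomial (ℤ ⊕ ℤ) ℂ))
          (fun x : ℤ => C (z ^ x))) f := by
  rw [← Derivation.smul_apply, ← Derivation.add_apply]
  congr 1
  refine MvPolynomial.derivation_ext fun v => ?_
  rcases v with x | x
  · simp [mkDerivation_X]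
  · simp [mkDerivation_X, smul_eq_C_mul, map_mul]

/-- `D^q_z` commutes with `Θ`. -/
theorem planeWaveQ_theta (z : ℂ) (f : MvPolynomial (ℤ ⊕ ℤ) ℂ) :
    MvPolynomial.mkDerivation ℂ (Sum.elim (fun x : ℤ => (C (z ^ x) : MvPolynomial (ℤ ⊕ ℤ) ℂ)) (fun _ : ℤ => 0))
      (MvPolynomial.aeval (R := ℂ) (Sum.elim (fun i : ℤ => (X (Sum.inl i) : MvPolynomial (ℤ ⊕ ℤ) ℂ))
        (fun i : ℤ => -X (Sum.inr i))) f) =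
    MvPolynomial.aeval (R := ℂ) (Sum.elim (fun i : ℤ => (X (Sum.inl i) : MvPolynomial (ℤ ⊕ ℤ) ℂ))
        (fun i : ℤ => -X (Sum.inr i)))
      (MvPolynomial.mkDerivation ℂ (Sum.elim (fun x : ℤ => (C (z ^ x) : MvPolynomial (ℤ ⊕ ℤ) ℂ)) (fun _ : ℤ => 0)) f) :=
  mkDerivation_theta_of_parity' _ (fun i => by simp) (fun i => by simp) f

/-- `D^p_z` anticommutes with `Θ`. -/
theorem planeWaveP_theta (z : ℂ) (f : MvPolynomial (ℤ ⊕ ℤ) ℂ) :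
    MvPolynomial.mkDerivation ℂ (Sum.elim (fun _ : ℤ => (0 : MvPolynomial (ℤ ⊕ ℤ) ℂ)) (fun x : ℤ => C (z ^ x)))
      (MvPolynomial.aeval (R := ℂ) (Sum.elim (fun i : ℤ => (X (Sum.inl i) : MvPolynomial (ℤ ⊕ ℤ) ℂ))
        (fun i : ℤ => -X (Sum.inr i))) f) =
    -MvPolynomial.aeval (R := ℂ) (Sum.elim (fun i : ℤ => (X (Sum.inl i) : MvPolynomial (ℤ ⊕ ℤ) ℂ))
        (fun i : ℤ => -X (Sum.inr i)))
      (MvPolynomial.mkDerivation ℂ (Sum.elim (fun _ : ℤ => (0 : MvPolynomial (ℤ ⊕ ℤ) ℂ)) (fun x : ℤ => C (z ^ x))) f) :=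
  mkDerivation_theta_of_parity _ (fun i => by simp) (fun i => by simp) f

end PlaneWave


/-! ## Generic plane waves: Laurent dependence of double plane-wave transforms on `(z₁, z₂)` -/

/-- Evaluation of the generic Laurent power `Z^x` (`X j ^ x` for `x ≥ 0`, `X (j+2) ^ (-x)` for `x < 0`,
evaluated at `(z₁, z₂, z₁⁻¹, z₂⁻¹)`) is the `zpow`. -/
theorem eval_genericZPow (z₁ z₂ : ℂ) (j : Fin 2) (x : ℤ) (hz : ![z₁, z₂] j ≠ 0) :
    MvPolynomial.eval ![z₁, z₂, z₁⁻¹, z₂⁻¹]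
      (if 0 ≤ x then (X (Fin.castLE (by norm_num) j) : MvPolynomial (Fin 4) ℂ) ^ x.toNat
        else X (Fin.natAdd 2 j) ^ (-x).toNat) = (![z₁, z₂] j) ^ x := by
  have hcast : MvPolynomial.eval ![z₁, z₂, z₁⁻¹, z₂⁻¹] (X (Fin.castLE (by norm_num) j) : MvPolynomial (Fin 4) ℂ)
      = ![z₁, z₂] j := by
    fin_cases j <;> simp
  have hadd : MvPolynomial.eval ![z₁, z₂, z₁⁻¹, z₂⁻¹] (X (Fin.natAdd 2 j) : MvPolynomial (Fin 4) ℂ)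
      = (![z₁, z₂] j)⁻¹ := by
    fin_cases j <;> simp
  split_ifs with hx
  · rw [map_pow, hcast, ← zpow_natCast, Int.toNat_of_nonneg hx]
  · rw [map_pow, hadd, inv_pow, ← zpow_natCast, ← zpow_neg, Int.toNat_of_nonneg (by omega), neg_neg]

/-- **Laurent dependence.** For a fixed complex lattice polynomial `g` and constants `a₁ b₁ a₂ b₂`, the
constant coefficient of `D₁ (D₂ g)` with `D_j = mkDerivation ℂ (q_x ↦ a_j z_j^x, p_x ↦ b_j z_j^x)` is a
Laurent polynomial function of `(z₁, z₂)`: times `(z₁z₂)^N` it is a polynomial. -/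
theorem laurent_double_planeWave (g : MvPolynomial (ℤ ⊕ ℤ) ℂ) (a₁ b₁ a₂ b₂ : ℂ) :
    ∃ (N : ℕ) (p : MvPolynomial (Fin 2) ℂ), ∀ z₁ z₂ : ℂ, z₁ ≠ 0 → z₂ ≠ 0 →
      constantCoeff (MvPolynomial.mkDerivation ℂ (Sum.elim (fun x : ℤ => (C (a₁ * z₁ ^ x) : MvPolynomial (ℤ ⊕ ℤ) ℂ))
          (fun x : ℤ => C (b₁ * z₁ ^ x)))
        (MvPolynomial.mkDerivation ℂ (Sum.elim (fun x : ℤ => (C (a₂ * z₂ ^ x) : MvPolynomial (ℤ ⊕ ℤ) ℂ))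
          (fun x : ℤ => C (b₂ * z₂ ^ x))) g)) * (z₁ * z₂) ^ N = MvPolynomial.eval ![z₁, z₂] p := by
  classical
  -- generic powers over `(MvPolynomial (Fin 4) ℂ) = MvPolynomial (Fin 4) ℂ`
  let zp : Fin 2 → ℤ → MvPolynomial (Fin 4) ℂ := fun j x =>
    if 0 ≤ x then (X (Fin.castLE (by norm_num) j) : MvPolynomial (Fin 4) ℂ) ^ x.toNat else X (Fin.natAdd 2 j) ^ (-x).toNat
  let hG₁ : ℤ ⊕ ℤ → MvPolynomial (ℤ ⊕ ℤ) (MvPolynomial (Fin 4) ℂ) :=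
    Sum.elim (fun x : ℤ => C (C a₁ * zp 0 x)) (fun x : ℤ => C (C b₁ * zp 0 x))
  let hG₂ : ℤ ⊕ ℤ → MvPolynomial (ℤ ⊕ ℤ) (MvPolynomial (Fin 4) ℂ) :=
    Sum.elim (fun x : ℤ => C (C a₂ * zp 1 x)) (fun x : ℤ => C (C b₂ * zp 1 x))
  let gB : MvPolynomial (ℤ ⊕ ℤ) (MvPolynomial (Fin 4) ℂ) := MvPolynomial.map (C : ℂ →+* (MvPolynomial (Fin 4) ℂ)) g
  let Γ : (MvPolynomial (Fin 4) ℂ) := constantCoeff (MvPolynomial.mkDerivation (MvPolynomial (Fin 4) ℂ) hG₁ (MvPolynomial.mkDerivation (MvPolynomial (Fin 4) ℂ) hG₂ gB))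
  -- the specialisation
  have hspec : ∀ z₁ z₂ : ℂ, z₁ ≠ 0 → z₂ ≠ 0 →
      constantCoeff (MvPolynomial.mkDerivation ℂ (Sum.elim (fun x : ℤ => (C (a₁ * z₁ ^ x) : MvPolynomial (ℤ ⊕ ℤ) ℂ))
          (fun x : ℤ => C (b₁ * z₁ ^ x)))
        (MvPolynomial.mkDerivation ℂ (Sum.elim (fun x : ℤ => (C (a₂ * z₂ ^ x) : MvPolynomial (ℤ ⊕ ℤ) ℂ))
          (fun x : ℤ => C (b₂ * z₂ ^ x))) g)) = MvPolynomial.eval ![z₁, z₂, z₁⁻¹, z₂⁻¹] Γ := by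
    intro z₁ z₂ hz₁ hz₂
    let ev : (MvPolynomial (Fin 4) ℂ) →+* ℂ := MvPolynomial.eval ![z₁, z₂, z₁⁻¹, z₂⁻¹]
    have hev1 : ∀ x : ℤ, ev (zp 0 x) = z₁ ^ x := fun x => eval_genericZPow z₁ z₂ 0 x (by simpa using hz₁)
    have hev2 : ∀ x : ℤ, ev (zp 1 x) = z₂ ^ x := fun x => eval_genericZPow z₁ z₂ 1 x (by simpa using hz₂)
    have hgB : MvPolynomial.map ev gB = g := by
      rw [MvPolynomial.map_map]
      have : ev.comp (C : ℂ →+* (MvPolynomial (Fin 4) ℂ)) = RingHom.id ℂ :=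
        RingHom.ext fun r => MvPolynomial.eval_C r
      rw [this, MvPolynomial.map_id]
    have h2 : MvPolynomial.map ev (MvPolynomial.mkDerivation (MvPolynomial (Fin 4) ℂ) hG₂ gB) =
        MvPolynomial.mkDerivation ℂ (Sum.elim (fun x : ℤ => (C (a₂ * z₂ ^ x) : MvPolynomial (ℤ ⊕ ℤ) ℂ))
          (fun x : ℤ => C (b₂ * z₂ ^ x))) g := by
      rw [map_mkDerivation ev hG₂ _ (fun v => ?_), hgB]
      rcases v with x | x <;> simp [hG₂, map_C, hev2, ev, MvPolynomial.eval_C]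
    have h1 : MvPolynomial.map ev (MvPolynomial.mkDerivation (MvPolynomial (Fin 4) ℂ) hG₁ (MvPolynomial.mkDerivation (MvPolynomial (Fin 4) ℂ) hG₂ gB)) =
        MvPolynomial.mkDerivation ℂ (Sum.elim (fun x : ℤ => (C (a₁ * z₁ ^ x) : MvPolynomial (ℤ ⊕ ℤ) ℂ))
          (fun x : ℤ => C (b₁ * z₁ ^ x)))
        (MvPolynomial.mkDerivation ℂ (Sum.elim (fun x : ℤ => (C (a₂ * z₂ ^ x) : MvPolynomial (ℤ ⊕ ℤ) ℂ))
          (fun x : ℤ => C (b₂ * z₂ ^ x))) g) := by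
      rw [map_mkDerivation ev hG₁ _ (fun v => ?_), h2]
      rcases v with x | x <;> simp [hG₁, map_C, hev1, ev, MvPolynomial.eval_C]
    rw [← h1, constantCoeff_map]
  -- clearing denominators in `Γ`
  let N : ℕ := Γ.totalDegree
  refine ⟨N, ∑ d ∈ Γ.support, C (coeff d Γ) * X 0 ^ (d 0 + N - d 2) * X 1 ^ (d 1 + N - d 3), ?_⟩
  intro z₁ z₂ hz₁ hz₂
  rw [hspec z₁ z₂ hz₁ hz₂, MvPolynomial.eval_eq', Finset.sum_mul, map_sum]
  refine Finset.sum_congr rfl fun d hd => ?_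
  have hdeg : ∀ i, d i ≤ N := fun i => by
    have h1 := Finsupp.le_degree i d
    have h2 : d.degree ≤ N := by
      rw [Finsupp.degree_apply]
      exact le_totalDegree hd
    exact h1.trans h2
  simp only [map_mul, map_pow, eval_C, eval_X, Fin.prod_univ_four, Matrix.cons_val_zero, Matrix.cons_val_one,
    Matrix.cons_val]
  have e1 : z₁ ^ (d 0) * z₁⁻¹ ^ (d 2) * z₁ ^ N = z₁ ^ (d 0 + N - d 2) := by
    rw [inv_pow, show d 0 + N - d 2 = d 0 + (N - d 2) by have := hdeg 2; omega, pow_add,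
      pow_sub₀ _ hz₁ (hdeg 2)]
    ring
  have e2 : z₂ ^ (d 1) * z₂⁻¹ ^ (d 3) * z₂ ^ N = z₂ ^ (d 1 + N - d 3) := by
    rw [inv_pow, show d 1 + N - d 3 = d 1 + (N - d 3) by have := hdeg 3; omega, pow_add,
      pow_sub₀ _ hz₂ (hdeg 3)]
    ring
  rw [mul_pow, ← e1, ← e2]
  ring


/-! ## The structure theorem -/

/-- Constant coefficient of a scalar multiple. -/
theorem constantCoeff_smul' (μ : ℂ) (f : MvPolynomial (ℤ ⊕ ℤ) ℂ) : constantCoeff (μ • f) = μ * constantCoeff f := by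
  rw [smul_eq_C_mul, map_mul, constantCoeff_C]

/-- **Structure of the triple plane-wave transform of a momentum-even polynomial.** For `f` with `Θ f = f`
there are LAURENT coefficient functions `c0, c12, c13, c23` of `(z₁, z₂)` with
`constantCoeff (D_(z₁,μ₁) (D_(z₂,μ₂) (D_(1,μ₃) f))) = c0 + μ₁μ₂ c12 + μ₁μ₃ c13 + μ₂μ₃ c23`
(`D_(1,μ₃) = mkDerivation (q ↦ 1, p ↦ μ₃)`): the words with an odd number of momentum derivatives vanish. -/
theorem planeWave3_even_structure (f : MvPolynomial (ℤ ⊕ ℤ) ℂ)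
    (heven : MvPolynomial.aeval (R := ℂ) (Sum.elim (fun i : ℤ => (X (Sum.inl i) : MvPolynomial (ℤ ⊕ ℤ) ℂ))
      (fun i : ℤ => -X (Sum.inr i))) f = f) :
    ∃ c0 c12 c13 c23 : ℂ → ℂ → ℂ,
      (∀ g ∈ [c0, c12, c13, c23], ∃ (N : ℕ) (p : MvPolynomial (Fin 2) ℂ), ∀ z₁ z₂ : ℂ, z₁ ≠ 0 → z₂ ≠ 0 →
          g z₁ z₂ * (z₁ * z₂) ^ N = MvPolynomial.eval ![z₁, z₂] p) ∧
      ∀ z₁ z₂ μ₁ μ₂ μ₃ : ℂ,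
        constantCoeff
          (MvPolynomial.mkDerivation ℂ (Sum.elim (fun x : ℤ => (C (z₁ ^ x) : MvPolynomial (ℤ ⊕ ℤ) ℂ))
              (fun x : ℤ => C (μ₁ * z₁ ^ x)))
            (MvPolynomial.mkDerivation ℂ (Sum.elim (fun x : ℤ => (C (z₂ ^ x) : MvPolynomial (ℤ ⊕ ℤ) ℂ))
                (fun x : ℤ => C (μ₂ * z₂ ^ x)))
              (MvPolynomial.mkDerivation ℂ (Sum.elim (fun _ : ℤ => (1 : MvPolynomial (ℤ ⊕ ℤ) ℂ))
                (fun _ : ℤ => C μ₃)) f))) =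
        c0 z₁ z₂ + μ₁ * μ₂ * c12 z₁ z₂ + μ₁ * μ₃ * c13 z₁ z₂ + μ₂ * μ₃ * c23 z₁ z₂ := by
  -- the elementary derivations, as members of the two-parameter family of `laurent_double_planeWave`
  have fam : ∀ (a b z : ℂ) (g : MvPolynomial (ℤ ⊕ ℤ) ℂ),
      MvPolynomial.mkDerivation ℂ (Sum.elim (fun x : ℤ => (C (a * z ^ x) : MvPolynomial (ℤ ⊕ ℤ) ℂ))
        (fun x : ℤ => C (b * z ^ x))) g =
      a • MvPolynomial.mkDerivation ℂ (Sum.elim (fun x : ℤ => (C (z ^ x) : MvPolynomial (ℤ ⊕ ℤ) ℂ)) (fun _ : ℤ => 0)) g +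
        b • MvPolynomial.mkDerivation ℂ (Sum.elim (fun _ : ℤ => (0 : MvPolynomial (ℤ ⊕ ℤ) ℂ)) (fun x : ℤ => C (z ^ x))) g := by
    intro a b z g
    rw [← Derivation.smul_apply, ← Derivation.smul_apply, ← Derivation.add_apply]
    congr 1
    refine MvPolynomial.derivation_ext fun v => ?_
    rcases v with x | x <;> simp [mkDerivation_X, smul_eq_C_mul, map_mul]
  -- the third wave splits as `Dq1 + μ₃ Dp1`
  have split3 : ∀ (μ₃ : ℂ) (g : MvPolynomial (ℤ ⊕ ℤ) ℂ),
      MvPolynomial.mkDerivation ℂ (Sum.elim (fun _ : ℤ => (1 : MvPolynomial (ℤ ⊕ ℤ) ℂ)) (fun _ : ℤ => C μ₃)) g =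
      MvPolynomial.mkDerivation ℂ (Sum.elim (fun x : ℤ => (C ((1 : ℂ) ^ x) : MvPolynomial (ℤ ⊕ ℤ) ℂ)) (fun _ : ℤ => 0)) g +
        μ₃ • MvPolynomial.mkDerivation ℂ (Sum.elim (fun _ : ℤ => (0 : MvPolynomial (ℤ ⊕ ℤ) ℂ))
          (fun x : ℤ => C ((1 : ℂ) ^ x))) g := by
    intro μ₃ g
    rw [← Derivation.smul_apply, ← Derivation.add_apply]
    congr 1
    refine MvPolynomial.derivation_ext fun v => ?_
    rcases v with x | x <;> simp [mkDerivation_X, smul_eq_C_mul]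
  -- notation-free names for the four even words (as functions of z₁ z₂)
  refine ⟨fun z₁ z₂ => constantCoeff
      (MvPolynomial.mkDerivation ℂ (Sum.elim (fun x : ℤ => (C (z₁ ^ x) : MvPolynomial (ℤ ⊕ ℤ) ℂ)) (fun _ : ℤ => 0))
        (MvPolynomial.mkDerivation ℂ (Sum.elim (fun x : ℤ => (C (z₂ ^ x) : MvPolynomial (ℤ ⊕ ℤ) ℂ)) (fun _ : ℤ => 0))
          (MvPolynomial.mkDerivation ℂ (Sum.elim (fun x : ℤ => (C ((1 : ℂ) ^ x) : MvPolynomial (ℤ ⊕ ℤ) ℂ)) (fun _ : ℤ => 0)) f))),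
    fun z₁ z₂ => constantCoeff
      (MvPolynomial.mkDerivation ℂ (Sum.elim (fun _ : ℤ => (0 : MvPolynomial (ℤ ⊕ ℤ) ℂ)) (fun x : ℤ => C (z₁ ^ x)))
        (MvPolynomial.mkDerivation ℂ (Sum.elim (fun _ : ℤ => (0 : MvPolynomial (ℤ ⊕ ℤ) ℂ)) (fun x : ℤ => C (z₂ ^ x)))
          (MvPolynomial.mkDerivation ℂ (Sum.elim (fun x : ℤ => (C ((1 : ℂ) ^ x) : MvPolynomial (ℤ ⊕ ℤ) ℂ)) (fun _ : ℤ => 0)) f))),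
    fun z₁ z₂ => constantCoeff
      (MvPolynomial.mkDerivation ℂ (Sum.elim (fun _ : ℤ => (0 : MvPolynomial (ℤ ⊕ ℤ) ℂ)) (fun x : ℤ => C (z₁ ^ x)))
        (MvPolynomial.mkDerivation ℂ (Sum.elim (fun x : ℤ => (C (z₂ ^ x) : MvPolynomial (ℤ ⊕ ℤ) ℂ)) (fun _ : ℤ => 0))
          (MvPolynomial.mkDerivation ℂ (Sum.elim (fun _ : ℤ => (0 : MvPolynomial (ℤ ⊕ ℤ) ℂ)) (fun x : ℤ => C ((1 : ℂ) ^ x))) f))),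
    fun z₁ z₂ => constantCoeff
      (MvPolynomial.mkDerivation ℂ (Sum.elim (fun x : ℤ => (C (z₁ ^ x) : MvPolynomial (ℤ ⊕ ℤ) ℂ)) (fun _ : ℤ => 0))
        (MvPolynomial.mkDerivation ℂ (Sum.elim (fun _ : ℤ => (0 : MvPolynomial (ℤ ⊕ ℤ) ℂ)) (fun x : ℤ => C (z₂ ^ x)))
          (MvPolynomial.mkDerivation ℂ (Sum.elim (fun _ : ℤ => (0 : MvPolynomial (ℤ ⊕ ℤ) ℂ)) (fun x : ℤ => C ((1 : ℂ) ^ x))) f))),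
    ?_, ?_⟩
  · -- Laurent property of each of the four words: instances of `laurent_double_planeWave`
    have inst : ∀ (a₁ b₁ a₂ b₂ : ℂ) (g : MvPolynomial (ℤ ⊕ ℤ) ℂ),
        ∃ (N : ℕ) (p : MvPolynomial (Fin 2) ℂ), ∀ z₁ z₂ : ℂ, z₁ ≠ 0 → z₂ ≠ 0 →
        constantCoeff (a₁ • MvPolynomial.mkDerivation ℂ (Sum.elim (fun x : ℤ => (C (z₁ ^ x) : MvPolynomial (ℤ ⊕ ℤ) ℂ)) (fun _ : ℤ => 0))
            (a₂ • MvPolynomial.mkDerivation ℂ (Sum.elim (fun x : ℤ => (C (z₂ ^ x) : MvPolynomial (ℤ ⊕ ℤ) ℂ)) (fun _ : ℤ => 0)) g +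
              b₂ • MvPolynomial.mkDerivation ℂ (Sum.elim (fun _ : ℤ => (0 : MvPolynomial (ℤ ⊕ ℤ) ℂ)) (fun x : ℤ => C (z₂ ^ x))) g) +
          b₁ • MvPolynomial.mkDerivation ℂ (Sum.elim (fun _ : ℤ => (0 : MvPolynomial (ℤ ⊕ ℤ) ℂ)) (fun x : ℤ => C (z₁ ^ x)))
            (a₂ • MvPolynomial.mkDerivation ℂ (Sum.elim (fun x : ℤ => (C (z₂ ^ x) : MvPolynomial (ℤ ⊕ ℤ) ℂ)) (fun _ : ℤ => 0)) g +
              b₂ • MvPolynomial.mkDerivation ℂ (Sum.elim (fun _ : ℤ => (0 : MvPolynomial (ℤ ⊕ ℤ) ℂ)) (fun x : ℤ => C (z₂ ^ x))) g))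
          * (z₁ * z₂) ^ N = MvPolynomial.eval ![z₁, z₂] p := by
      intro a₁ b₁ a₂ b₂ g
      obtain ⟨N, p, hp⟩ := laurent_double_planeWave g a₁ b₁ a₂ b₂
      refine ⟨N, p, fun z₁ z₂ hz₁ hz₂ => ?_⟩
      rw [← hp z₁ z₂ hz₁ hz₂, fam, fam]
    intro g hg
    simp only [List.mem_cons, List.mem_nil_iff, or_false] at hg
    rcases hg with rfl | rfl | rfl | rfl
    · obtain ⟨N, p, hp⟩ := inst 1 0 1 0
        (MvPolynomial.mkDerivation ℂ (Sum.elim (fun x : ℤ => (C ((1 : ℂ) ^ x) : MvPolynomial (ℤ ⊕ ℤ) ℂ)) (fun _ : ℤ => 0)) f)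
      exact ⟨N, p, fun z₁ z₂ hz₁ hz₂ => by simpa using hp z₁ z₂ hz₁ hz₂⟩
    · obtain ⟨N, p, hp⟩ := inst 0 1 0 1
        (MvPolynomial.mkDerivation ℂ (Sum.elim (fun x : ℤ => (C ((1 : ℂ) ^ x) : MvPolynomial (ℤ ⊕ ℤ) ℂ)) (fun _ : ℤ => 0)) f)
      exact ⟨N, p, fun z₁ z₂ hz₁ hz₂ => by simpa using hp z₁ z₂ hz₁ hz₂⟩
    · obtain ⟨N, p, hp⟩ := inst 0 1 1 0
        (MvPolynomial.mkDerivation ℂ (Sum.elim (fun _ : ℤ => (0 : MvPolynomial (ℤ ⊕ ℤ) ℂ)) (fun x : ℤ => C ((1 : ℂ) ^ x))) f)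
      exact ⟨N, p, fun z₁ z₂ hz₁ hz₂ => by simpa using hp z₁ z₂ hz₁ hz₂⟩
    · obtain ⟨N, p, hp⟩ := inst 1 0 0 1
        (MvPolynomial.mkDerivation ℂ (Sum.elim (fun _ : ℤ => (0 : MvPolynomial (ℤ ⊕ ℤ) ℂ)) (fun x : ℤ => C ((1 : ℂ) ^ x))) f)
      exact ⟨N, p, fun z₁ z₂ hz₁ hz₂ => by simpa using hp z₁ z₂ hz₁ hz₂⟩
  · intro z₁ z₂ μ₁ μ₂ μ₃
    -- parity transport through the elementary derivations
    have thetaQ : ∀ (z : ℂ) (g : MvPolynomial (ℤ ⊕ ℤ) ℂ),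
        MvPolynomial.aeval (R := ℂ) (Sum.elim (fun i : ℤ => (X (Sum.inl i) : MvPolynomial (ℤ ⊕ ℤ) ℂ))
          (fun i : ℤ => -X (Sum.inr i)))
          (MvPolynomial.mkDerivation ℂ (Sum.elim (fun x : ℤ => (C (z ^ x) : MvPolynomial (ℤ ⊕ ℤ) ℂ)) (fun _ : ℤ => 0)) g) =
        MvPolynomial.mkDerivation ℂ (Sum.elim (fun x : ℤ => (C (z ^ x) : MvPolynomial (ℤ ⊕ ℤ) ℂ)) (fun _ : ℤ => 0))
          (MvPolynomial.aeval (R := ℂ) (Sum.elim (fun i : ℤ => (X (Sum.inl i) : MvPolynomial (ℤ ⊕ ℤ) ℂ))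
            (fun i : ℤ => -X (Sum.inr i))) g) := fun z g => (planeWaveQ_theta z g).symm
    have thetaP : ∀ (z : ℂ) (g : MvPolynomial (ℤ ⊕ ℤ) ℂ),
        MvPolynomial.aeval (R := ℂ) (Sum.elim (fun i : ℤ => (X (Sum.inl i) : MvPolynomial (ℤ ⊕ ℤ) ℂ))
          (fun i : ℤ => -X (Sum.inr i)))
          (MvPolynomial.mkDerivation ℂ (Sum.elim (fun _ : ℤ => (0 : MvPolynomial (ℤ ⊕ ℤ) ℂ)) (fun x : ℤ => C (z ^ x))) g) =
        -MvPolynomial.mkDerivation ℂ (Sum.elim (fun _ : ℤ => (0 : MvPolynomial (ℤ ⊕ ℤ) ℂ)) (fun x : ℤ => C (z ^ x)))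
          (MvPolynomial.aeval (R := ℂ) (Sum.elim (fun i : ℤ => (X (Sum.inl i) : MvPolynomial (ℤ ⊕ ℤ) ℂ))
            (fun i : ℤ => -X (Sum.inr i))) g) := by
      intro z g
      have h := planeWaveP_theta z (MvPolynomial.aeval (R := ℂ)
        (Sum.elim (fun i : ℤ => (X (Sum.inl i) : MvPolynomial (ℤ ⊕ ℤ) ℂ)) (fun i : ℤ => -X (Sum.inr i))) g)
      rw [theta_theta] at h
      rw [h, map_neg, theta_theta]
    -- a Θ-odd polynomial has zero constant coefficient
    have oddcc : ∀ g : MvPolynomial (ℤ ⊕ ℤ) ℂ,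
        MvPolynomial.aeval (R := ℂ) (Sum.elim (fun i : ℤ => (X (Sum.inl i) : MvPolynomial (ℤ ⊕ ℤ) ℂ))
          (fun i : ℤ => -X (Sum.inr i))) g = -g → constantCoeff g = 0 := by
      intro g hg
      have hc := congrArg constantCoeff hg
      rw [constantCoeff_theta, map_neg] at hc
      exact self_eq_neg.mp hc
    -- the four odd words vanish
    have o1 : constantCoeff
        (MvPolynomial.mkDerivation ℂ (Sum.elim (fun x : ℤ => (C (z₁ ^ x) : MvPolynomial (ℤ ⊕ ℤ) ℂ)) (fun _ : ℤ => 0))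
          (MvPolynomial.mkDerivation ℂ (Sum.elim (fun x : ℤ => (C (z₂ ^ x) : MvPolynomial (ℤ ⊕ ℤ) ℂ)) (fun _ : ℤ => 0))
            (MvPolynomial.mkDerivation ℂ (Sum.elim (fun _ : ℤ => (0 : MvPolynomial (ℤ ⊕ ℤ) ℂ)) (fun x : ℤ => C ((1 : ℂ) ^ x))) f))) = 0 := by
      apply oddcc
      rw [thetaQ, thetaQ, thetaP, heven, map_neg, map_neg]
    have o2 : constantCoeff
        (MvPolynomial.mkDerivation ℂ (Sum.elim (fun x : ℤ => (C (z₁ ^ x) : MvPolynomial (ℤ ⊕ ℤ) ℂ)) (fun _ : ℤ => 0))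
          (MvPolynomial.mkDerivation ℂ (Sum.elim (fun _ : ℤ => (0 : MvPolynomial (ℤ ⊕ ℤ) ℂ)) (fun x : ℤ => C (z₂ ^ x)))
            (MvPolynomial.mkDerivation ℂ (Sum.elim (fun x : ℤ => (C ((1 : ℂ) ^ x) : MvPolynomial (ℤ ⊕ ℤ) ℂ)) (fun _ : ℤ => 0)) f))) = 0 := by
      apply oddcc
      rw [thetaQ, thetaP, thetaQ, heven, map_neg]
    have o3 : constantCoeff
        (MvPolynomial.mkDerivation ℂ (Sum.elim (fun _ : ℤ => (0 : MvPolynomial (ℤ ⊕ ℤ) ℂ)) (fun x : ℤ => C (z₁ ^ x)))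
          (MvPolynomial.mkDerivation ℂ (Sum.elim (fun x : ℤ => (C (z₂ ^ x) : MvPolynomial (ℤ ⊕ ℤ) ℂ)) (fun _ : ℤ => 0))
            (MvPolynomial.mkDerivation ℂ (Sum.elim (fun x : ℤ => (C ((1 : ℂ) ^ x) : MvPolynomial (ℤ ⊕ ℤ) ℂ)) (fun _ : ℤ => 0)) f))) = 0 := by
      apply oddcc
      rw [thetaP, thetaQ, thetaQ, heven]
    have o4 : constantCoeff
        (MvPolynomial.mkDerivation ℂ (Sum.elim (fun _ : ℤ => (0 : MvPolynomial (ℤ ⊕ ℤ) ℂ)) (fun x : ℤ => C (z₁ ^ x)))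
          (MvPolynomial.mkDerivation ℂ (Sum.elim (fun _ : ℤ => (0 : MvPolynomial (ℤ ⊕ ℤ) ℂ)) (fun x : ℤ => C (z₂ ^ x)))
            (MvPolynomial.mkDerivation ℂ (Sum.elim (fun _ : ℤ => (0 : MvPolynomial (ℤ ⊕ ℤ) ℂ)) (fun x : ℤ => C ((1 : ℂ) ^ x))) f))) = 0 := by
      apply oddcc
      rw [thetaP, thetaP, thetaP, heven, map_neg, map_neg, neg_neg, map_neg]
    -- expand the triple composition
    simp only [split3, planeWave_split, map_add, Derivation.map_smul, smul_add, constantCoeff_smul', o1, o2, o3, o4]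
    ring

/-- ANCHOR of this helper file (registered sub-goal of the crux): momentum reversal preserves the constant
coefficient of a complex lattice polynomial. -/
theorem mainReduction_constantCoeff_theta_anchor :
    ∀ f : MvPolynomial (ℤ ⊕ ℤ) ℂ, MvPolynomial.constantCoeff (MvPolynomial.aeval (Sum.elim (fun i : ℤ => (MvPolynomial.X (Sum.inl i) : MvPolynomial (ℤ ⊕ ℤ) ℂ)) (fun i : ℤ => -MvPolynomial.X (Sum.inr i))) f) = MvPolynomial.constantCoeff f :=
  fun f => constantCoeff_theta f

end Summit.AtomisticToContinuum.FouriersLaw.Theorems.DressedCharge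

end
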